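import Summits.AtomisticToContinuum.Crystallization.Theorems.FrustratedLawDichotomyMotifDoor
import Summits.AtomisticToContinuum.Crystallization.Theorems.FrustratedLawDichotomySchurCutB
import Literature.MathematicalPhysics.StatisticalMechanics.HardCoreGSC

/-!
# FrustratedLawDichotomy · the discharging / motif door for ANY finite-range pair functional — and lens-5 g34's SCHUR-CUT residuals

`…LocalDischargingRule` / `…MotifDoor` (hand-2 g12) serve lens-5 g33's residuals, whose right-hand side is `U_R − A·Σ m_i` (truncated
Lennard-Jones + density proxy).  Critic row 494 moved the residual of record to lens-5 g34's SCHUR CUT: `T′♭_{R₀}` =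
`SchurTopologicalPricing η₀ η₁ w ω A eUp κ_T C_T` (audit twin `FRG♭ = SchurRangeGap`), whose right-hand side is `Σ_{i<j} W(r_ij) − A·N` for the
effective FINITE-RANGE pair potential `W = effPot w ω A` (`W r = 0` for `r ≥ R₀`; `effPot_five_eq_zero`) and a CONSTANT one-body term `A`
(`…SchurCut`, `…SchurCutB`, landed p827771 / p827890).  This file states the door ONCE for an arbitrary pair potential `W` with a constant
one-body term and three level coefficients, and instantiates it at the Schur residuals:

* §1 `sum_le_interactionEnergy_of_transfers` — sitewise-after-transfers ⟹ `Σ_i level_i ≤ U_W(y) − A·N` for ANY `W`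
  (site term `(Σ_j W(r_ij) − W(0))/2`, i.e. half the sum over the OTHER sites; `two_mul_interactionEnergy_eq_sum_sum_sub`);
* §2 `PairRuleCertificate η₀ η₁ W A c₀ c₁ c₂ R′ ρ B F` — a rule of range `R′`, locality `ρ`, bound `B` (the classes of `…LocalDischargingRule`)
  certifying `c₀ + c₁·𝟙[η₀-good] + c₂·𝟙[η₁-good] ≤ (Σ_j W(r_ij) − W 0)/2 − A + netInflow_i` at every site of every Sep cluster;
  kernel `sum_le_of_pairRuleCertificate`; ★ instances `schurTopologicalPricing_of_rule` (`c = (eUp + κ_T, −C_T, −κ_T)`),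
  `schurRangeGap_of_rule` (`(e₁, −C, 0)`), `schurElasticPricing_of_rule` (`(eUp − D_E, −(κ_E + C_E), κ_E + D_E)`);
* §3 `PairRuleMotifCertificate … D ϱ F` (capped indicators `GoodAtScale`, motifs confined to radius `ϱ`) and ★★ THE DOOR
  `pairRuleCertificate_of_motif`: `W` vanishing from `R` on, `ϱ ≥ max (R, R′ + ρ, ρ, R′, 13/10·D + 1, 0)`, `c₁, c₂ ≤ 0` ⟹ (motif ⟹ every site).
  With a CONSTANT one-body term NO isolated-site condition is needed: the singleton motif prices an isolated atom by itself;
* §4 the residual of record BY NAME: `schurTopologicalPricing_of_motif`, ★★ `aperiodicFrustratedLawGap_of_schurMotif_five`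
  (`MuEquilibriumDoor ∧ SF₅ ∧ UP(−0.7175) ∧ E′♭₅ ∧ [rule F: range R′, locality ρ, bound B] ∧ motif certificate at radius ϱ ≥ max(5, …) ⟹ crux`),
  the mixed form `…_of_elastic_of_schurMotif_five` (E′ kept infinite-range), and the generic `…_of_schurMotif` for any certified `SchurFloor w ω A`
  whose `effPot` vanishes from `R` on.

[folklore] bookkeeping; 0 sorry.  Prover hand 2, gen 12 (decomp-a2c), `--supports stmt-AtomisticToContinuum-27623`.
-/

noncomputable section

namespace Summit.AtomisticToContinuum.Crystallization.Theorems.FrustratedLawDichotomyPairPotentialDoor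

open scoped BigOperators Classical
open Literature.MathematicalPhysics.StatisticalMechanics (interactionEnergy lennardJones two_mul_interactionEnergy_eq_sum_sum_sub)
open Summit.AtomisticToContinuum.Crystallization.Theorems.ChargedEnergyGapNegative (E3 eStar)
open Summit.AtomisticToContinuum.Crystallization.Theorems.FrustratedLawDichotomyRangeCut
open Summit.AtomisticToContinuum.Crystallization.Theorems.FrustratedLawDichotomyLocalPricing (sum_le_sum_of_transfers goodCount_eq_sum)
open Summit.AtomisticToContinuum.Crystallization.Theorems.FrustratedLawDichotomyLocalDischargingRule
open Summit.AtomisticToContinuum.Crystallization.Theorems.FrustratedLawDichotomyMotifLemmas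
open Summit.AtomisticToContinuum.Crystallization.Theorems.FrustratedLawDichotomySchurCut

/-! ## §1. Sitewise after transfers ⟹ global, for any pair potential with a constant one-body term -/

/-- `2·U_W(y) = Σ_i (Σ_j W(r_ij) − W(0))` (the diagonal term removed sitewise). [folklore] -/
theorem two_mul_interactionEnergy_eq_sum_site (W : ℝ → ℝ) {N : ℕ} (y : Fin N → E3) :
    2 * interactionEnergy W y = ∑ i, (∑ j, W (dist (y i) (y j)) - W 0) := by
  rw [two_mul_interactionEnergy_eq_sum_sum_sub W y, Finset.sum_sub_distrib, Finset.sum_const, Finset.card_univ, Fintype.card_fin,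
    nsmul_eq_mul]

/-- **Local ⟹ global for `U_W − A·N`**: if after some transfers every site meets its target against `(Σ_j W(r_ij) − W 0)/2 − A`, then
`Σ_i ℓ_i ≤ U_W(y) − A·N`. [folklore] -/
theorem sum_le_interactionEnergy_of_transfers (W : ℝ → ℝ) (A : ℝ) {N : ℕ} (y : Fin N → E3) {ℓ : Fin N → ℝ} (τ : Fin N → Fin N → ℝ)
    (h : ∀ i, ℓ i ≤ (∑ j, W (dist (y i) (y j)) - W 0) / 2 - A + (∑ j, τ j i - ∑ j, τ i j)) :
    ∑ i, ℓ i ≤ interactionEnergy W y - A * N := by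
  have hs := sum_le_sum_of_transfers τ h
  simp only [Finset.sum_sub_distrib, Finset.sum_const, Finset.card_univ, Fintype.card_fin, nsmul_eq_mul, ← Finset.sum_div] at hs
  have h2 := two_mul_interactionEnergy_eq_sum_site W y
  rw [Finset.sum_sub_distrib, Finset.sum_const, Finset.card_univ, Fintype.card_fin, nsmul_eq_mul] at h2
  linarith

/-! ## §2. The rule certificate for a pair functional and the Schur-cut residuals -/

/-- **`PairRuleCertificate η₀ η₁ W A c₀ c₁ c₂ R′ ρ B F`** — the rule `F` has range `R′`, locality radius `ρ`, bound `B`, and at EVERY site of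
EVERY injective `7/10`-separated cluster `c₀ + c₁·𝟙[η₀-good] + c₂·𝟙[η₁-good] ≤ (Σ_j W(r_ij) − W 0)/2 − A + netInflow_i`. -/
def PairRuleCertificate (η₀ η₁ : ℝ) (W : ℝ → ℝ) (A c₀ c₁ c₂ R' ρ B : ℝ) (F : TransferRule) : Prop :=
  HasRange R' F ∧ IsLocal ρ F ∧ IsBounded B F ∧
    ∀ (N : ℕ) (y : Fin N → E3), Function.Injective y → Sep y → ∀ i : Fin N,
      c₀ + c₁ * (if GoodAt η₀ y i then (1 : ℝ) else 0) + c₂ * (if GoodAt η₁ y i then (1 : ℝ) else 0) ≤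
        (∑ j, W (dist (y i) (y j)) - W 0) / 2 - A + netInflow F N y i

/-- **Kernel**: a rule certificate gives `c₀·N + c₁·g₀ + c₂·g₁ ≤ U_W − A·N` on every Sep cluster. [folklore] -/
theorem sum_le_of_pairRuleCertificate {η₀ η₁ : ℝ} {W : ℝ → ℝ} {A c₀ c₁ c₂ R' ρ B : ℝ} {F : TransferRule}
    (h : PairRuleCertificate η₀ η₁ W A c₀ c₁ c₂ R' ρ B F) (N : ℕ) (y : Fin N → E3) (hy : Function.Injective y) (hsep : Sep y) :
    c₀ * N + c₁ * goodCount η₀ y + c₂ * goodCount η₁ y ≤ interactionEnergy W y - A * N := by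
  have hs := sum_le_interactionEnergy_of_transfers W A y (F N y) (fun i => h.2.2.2 N y hy hsep i)
  simp only [Finset.sum_add_distrib, Finset.sum_const, Finset.card_univ, Fintype.card_fin, nsmul_eq_mul, ← Finset.mul_sum] at hs
  rw [← goodCount_eq_sum, ← goodCount_eq_sum] at hs
  linarith

/-- ★ **`T′♭ ⟸ rule certificate`** with `W = effPot w ω A`, `c = (eUp + κ_T, −C_T, −κ_T)`. [folklore] -/
theorem schurTopologicalPricing_of_rule {η₀ η₁ : ℝ} {w ω : ℝ → ℝ} {A eUp κT CT R' ρ B : ℝ} {F : TransferRule}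
    (h : PairRuleCertificate η₀ η₁ (effPot w ω A) A (eUp + κT) (-CT) (-κT) R' ρ B F) :
    SchurTopologicalPricing η₀ η₁ w ω A eUp κT CT := by
  intro N y hy hsep
  have := sum_le_of_pairRuleCertificate h N y hy hsep
  linarith

/-- ★ **`FRG♭ ⟸ rule certificate`** with `c = (e₁, −C, 0)` (the second tolerance is idle). [folklore] -/
theorem schurRangeGap_of_rule {η₁ : ℝ} {w ω : ℝ → ℝ} {A e₁ C R' ρ B : ℝ} {F : TransferRule}
    (h : PairRuleCertificate (1 / 20) η₁ (effPot w ω A) A e₁ (-C) 0 R' ρ B F) : SchurRangeGap w ω A e₁ C := by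
  intro N y hy hsep
  have := sum_le_of_pairRuleCertificate h N y hy hsep
  linarith

/-- **`E′♭ ⟸ rule certificate`** with `c = (eUp − D_E, −(κ_E + C_E), κ_E + D_E)`. [folklore] -/
theorem schurElasticPricing_of_rule {η₀ η₁ : ℝ} {w ω : ℝ → ℝ} {A eUp κE CE DE R' ρ B : ℝ} {F : TransferRule}
    (h : PairRuleCertificate η₀ η₁ (effPot w ω A) A (eUp - DE) (-(κE + CE)) (κE + DE) R' ρ B F) :
    SchurElasticPricing η₀ η₁ w ω A eUp κE CE DE := by
  intro N y hy hsep
  have := sum_le_of_pairRuleCertificate h N y hy hsep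
  linarith

/-! ## §3. Motif certificates and THE DOOR for a finite-range pair functional -/

/-- **`PairRuleMotifCertificate η₀ η₁ W A c₀ c₁ c₂ D ϱ F`** — the PER-MOTIF inequality with CAPPED indicators: for every injective
`7/10`-separated motif `z` (all atoms within `ϱ` of the centre `c`),
`c₀ + c₁·𝟙[GoodAtScale η₀ D] + c₂·𝟙[GoodAtScale η₁ D] ≤ (Σ_a W(dist (z c) (z a)) − W 0)/2 − A + netInflow F M z c`. -/
def PairRuleMotifCertificate (η₀ η₁ : ℝ) (W : ℝ → ℝ) (A c₀ c₁ c₂ D ϱ : ℝ) (F : TransferRule) : Prop :=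
  ∀ (M : ℕ) (z : Fin M → E3), Function.Injective z → Sep z → ∀ c : Fin M, (∀ a : Fin M, dist (z a) (z c) ≤ ϱ) →
    c₀ + c₁ * (if GoodAtScale η₀ D z c then (1 : ℝ) else 0) + c₂ * (if GoodAtScale η₁ D z c then (1 : ℝ) else 0) ≤
      (∑ a, W (dist (z c) (z a)) - W 0) / 2 - A + netInflow F M z c

/-- **The pair sum of the centre agrees** between cluster and motif for `W` vanishing from `R ≤ ϱ` on. [folklore] -/
theorem pairSum_motif {W : ℝ → ℝ} {R ϱ : ℝ} (hW : ∀ r, R ≤ r → W r = 0) (hR : R ≤ ϱ) {N M : ℕ} {y : Fin N → E3}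
    {S : Finset (Fin N)} (φ : Fin M ↪o Fin N) (hφ : Set.range φ = ↑S) {c : Fin M} (hSdef : ∀ j, j ∈ S ↔ dist (y j) (y (φ c)) ≤ ϱ) :
    ∑ a : Fin M, W (dist ((y ∘ φ) c) ((y ∘ φ) a)) = ∑ j, W (dist (y (φ c)) (y j)) := by
  rw [sum_eq_sum_of_vanish S (fun j => W (dist (y (φ c)) (y j))) fun j hj => ?_]
  · exact sum_orderEmb φ hφ (fun j => W (dist (y (φ c)) (y j)))
  · have : ϱ < dist (y j) (y (φ c)) := lt_of_not_ge fun h => hj ((hSdef j).2 h)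
    rw [dist_comm] at this
    exact hW _ (by linarith)

/-- **THE MOTIF LEMMA for a pair functional**: at every site `i` of a cluster the motif `S = {j : dist (y j) (y i) ≤ ϱ}` carries the same
right-hand side, and capped goodness of its centre implies goodness in the cluster (no isolated-site case: `i ∈ S` always). [folklore] -/
theorem motif_transferW {W : ℝ → ℝ} {R R' ρ ϱ A D : ℝ} {F : TransferRule} (hW : ∀ r, R ≤ r → W r = 0)
    (hF₁ : HasRange R' F) (hF₂ : IsLocal ρ F)
    (h0 : 0 ≤ ϱ) (hR : R ≤ ϱ) (hRρ : R' + ρ ≤ ϱ) (hρ : ρ ≤ ϱ) (hR' : R' ≤ ϱ) (hD : 13 / 10 * D + 1 ≤ ϱ)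
    {N : ℕ} {y : Fin N → E3} (hy : Function.Injective y) (hsep : Sep y) (i : Fin N) :
    ∃ (M : ℕ) (z : Fin M → E3) (c : Fin M), Function.Injective z ∧ Sep z ∧ (∀ a : Fin M, dist (z a) (z c) ≤ ϱ) ∧
      (∑ a, W (dist (z c) (z a)) - W 0) / 2 - A + netInflow F M z c =
        (∑ j, W (dist (y i) (y j)) - W 0) / 2 - A + netInflow F N y i ∧
      (∀ η : ℝ, GoodAtScale η D z c → GoodAt η y i) := by
  set S : Finset (Fin N) := Finset.univ.filter (fun j => dist (y j) (y i) ≤ ϱ) with hS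
  have hSdef0 : ∀ j, j ∈ S ↔ dist (y j) (y i) ≤ ϱ := fun j => by simp [hS]
  have hiS : i ∈ S := (hSdef0 i).2 (by rw [dist_self]; exact h0)
  let φ : Fin S.card ↪o Fin N := S.orderEmbOfFin rfl
  have hφ : Set.range φ = ↑S := Finset.range_orderEmbOfFin S rfl
  have hiφ : i ∈ Set.range φ := by rw [hφ]; exact hiS
  obtain ⟨c, hc⟩ := hiφ
  have hSdef : ∀ j, j ∈ S ↔ dist (y j) (y (φ c)) ≤ ϱ := by rw [hc]; exact hSdef0
  have hSr : ∀ k : Fin N, dist (y k) (y (φ c)) ≤ ϱ → k ∈ Set.range φ := fun k hk => by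
    rw [hφ]; exact (hSdef k).2 hk
  have hφinj : Function.Injective φ := φ.injective
  refine ⟨S.card, y ∘ φ, c, hy.comp hφinj, fun a b hab => hsep (φ a) (φ b) (hφinj.ne hab), fun a => ?_, ?_, fun η hη => ?_⟩
  · have ha : φ a ∈ S := by
      have h : φ a ∈ Set.range φ := ⟨a, rfl⟩
      rw [hφ] at h
      exact h
    exact (hSdef (φ a)).1 ha
  · have e1 : ∑ a, W (dist ((y ∘ φ) c) ((y ∘ φ) a)) = ∑ j, W (dist (y (φ c)) (y j)) := pairSum_motif hW hR φ hφ hSdef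
    have e3 : netInflow F S.card (y ∘ φ) c = netInflow F N y (φ c) := netInflow_motif hF₁ hF₂ hRρ hρ hR' φ hφ hSdef
    rw [e1, e3, hc]
  · rw [← hc]; exact goodAt_of_motif hSr hD hη

/-- ★★ **THE DOOR for a finite-range pair functional**: `W` vanishing from `R` on, a rule of range `R′`, locality `ρ`, bound `B`, motif radius
`ϱ ≥ max (R, R′ + ρ, ρ, R′, 13/10·D + 1, 0)` and NONPOSITIVE credit coefficients `c₁, c₂ ≤ 0`: motif certificate ⟹ rule certificate. [folklore] -/
theorem pairRuleCertificate_of_motif {η₀ η₁ : ℝ} {W : ℝ → ℝ} {R A c₀ c₁ c₂ D ϱ R' ρ B : ℝ} {F : TransferRule}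
    (hW : ∀ r, R ≤ r → W r = 0) (hF₁ : HasRange R' F) (hF₂ : IsLocal ρ F) (hF₃ : IsBounded B F)
    (h0 : 0 ≤ ϱ) (hR : R ≤ ϱ) (hRρ : R' + ρ ≤ ϱ) (hρ : ρ ≤ ϱ) (hR' : R' ≤ ϱ) (hD : 13 / 10 * D + 1 ≤ ϱ)
    (hc₁ : c₁ ≤ 0) (hc₂ : c₂ ≤ 0) (h : PairRuleMotifCertificate η₀ η₁ W A c₀ c₁ c₂ D ϱ F) :
    PairRuleCertificate η₀ η₁ W A c₀ c₁ c₂ R' ρ B F := by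
  refine ⟨hF₁, hF₂, hF₃, fun N y hy hsep i => ?_⟩
  obtain ⟨M, z, c, hz, hzsep, hconf, hrhs, hgood⟩ := motif_transferW (A := A) hW hF₁ hF₂ h0 hR hRρ hρ hR' hD hy hsep i
  have hm := h M z hz hzsep c hconf
  rw [hrhs] at hm
  have e0 := mul_le_mul_of_nonpos_left (ite_le_ite_of_imp (hgood η₀)) hc₁
  have e1 := mul_le_mul_of_nonpos_left (ite_le_ite_of_imp (hgood η₁)) hc₂
  linarith

/-! ## §4. The Schur-cut residual of record through the door, and the crux BY NAME -/

/-- ★ **`T′♭ ⟸ motif certificate`** (`effPot w ω A` vanishing from `R` on; `0 ≤ κ_T, C_T`). [folklore chaining] -/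
theorem schurTopologicalPricing_of_motif {η₀ η₁ : ℝ} {w ω : ℝ → ℝ} {A eUp κT CT R D ϱ R' ρ B : ℝ} {F : TransferRule}
    (hW : ∀ r, R ≤ r → effPot w ω A r = 0) (hF₁ : HasRange R' F) (hF₂ : IsLocal ρ F) (hF₃ : IsBounded B F)
    (h0 : 0 ≤ ϱ) (hR : R ≤ ϱ) (hRρ : R' + ρ ≤ ϱ) (hρ : ρ ≤ ϱ) (hR' : R' ≤ ϱ) (hD : 13 / 10 * D + 1 ≤ ϱ)
    (hκ : 0 ≤ κT) (hC : 0 ≤ CT)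
    (h : PairRuleMotifCertificate η₀ η₁ (effPot w ω A) A (eUp + κT) (-CT) (-κT) D ϱ F) :
    SchurTopologicalPricing η₀ η₁ w ω A eUp κT CT :=
  schurTopologicalPricing_of_rule
    (pairRuleCertificate_of_motif hW hF₁ hF₂ hF₃ h0 hR hRρ hρ hR' hD (by linarith) (by linarith) h)

/-- **`FRG♭ ⟸ motif certificate`** (`0 ≤ C`). [folklore chaining] -/
theorem schurRangeGap_of_motif {η₁ : ℝ} {w ω : ℝ → ℝ} {A e₁ C R D ϱ R' ρ B : ℝ} {F : TransferRule}
    (hW : ∀ r, R ≤ r → effPot w ω A r = 0) (hF₁ : HasRange R' F) (hF₂ : IsLocal ρ F) (hF₃ : IsBounded B F)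
    (h0 : 0 ≤ ϱ) (hR : R ≤ ϱ) (hRρ : R' + ρ ≤ ϱ) (hρ : ρ ≤ ϱ) (hR' : R' ≤ ϱ) (hD : 13 / 10 * D + 1 ≤ ϱ) (hC : 0 ≤ C)
    (h : PairRuleMotifCertificate (1 / 20) η₁ (effPot w ω A) A e₁ (-C) 0 D ϱ F) : SchurRangeGap w ω A e₁ C :=
  schurRangeGap_of_rule (pairRuleCertificate_of_motif hW hF₁ hF₂ hF₃ h0 hR hRρ hρ hR' hD (by linarith) le_rfl h)

/-- ★ **The crux from a Schur floor, E′♭ and ONE motif-certified rule beneath `T′♭`** (generic `w ω A` with `effPot` vanishing from `R` on).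
[folklore chaining] -/
theorem aperiodicFrustratedLawGap_of_schurMotif {η₁ : ℝ} {w ω : ℝ → ℝ} {A eUp κT CT κE CE DE R D ϱ R' ρ B : ℝ} {F : TransferRule}
    (h01 : (1 : ℝ) / 20 ≤ η₁)
    (hDoor : Summit.AtomisticToContinuum.Crystallization.Theses.GrainCoreNetworkSplit.MuEquilibriumDoor)
    (hSF : SchurFloor w ω A) (hU : PeriodicEnergyCeiling eUp) (hκT : 0 < κT) (hκE : 0 < κE)
    (hE : SchurElasticPricing (1 / 20) η₁ w ω A eUp κE CE DE)
    (hW : ∀ r, R ≤ r → effPot w ω A r = 0) (hF₁ : HasRange R' F) (hF₂ : IsLocal ρ F) (hF₃ : IsBounded B F)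
    (h0 : 0 ≤ ϱ) (hR : R ≤ ϱ) (hRρ : R' + ρ ≤ ϱ) (hρ : ρ ≤ ϱ) (hR' : R' ≤ ϱ) (hD : 13 / 10 * D + 1 ≤ ϱ) (hC : 0 ≤ CT)
    (h : PairRuleMotifCertificate (1 / 20) η₁ (effPot w ω A) A (eUp + κT) (-CT) (-κT) D ϱ F) :
    Summit.AtomisticToContinuum.Crystallization.Theses.FrustratedLawDichotomy.AperiodicFrustratedLawGap :=
  aperiodicFrustratedLawGap_of_split_schurCut h01 hDoor hSF hU hκT
    (schurTopologicalPricing_of_motif hW hF₁ hF₂ hF₃ h0 hR hRρ hρ hR' hD hκT.le hC h) hκE hE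

/-- ★★ **The crux at lens-5 g34's RANGE-5 node from ONE motif-certified rule**:
`MuEquilibriumDoor ∧ SF₅ ∧ UP(−0.7175) ∧ E′♭₅(κ_E = 1/1000) ∧ [F: range R′, locality ρ, bound B] ∧ motif certificate (W₅ = effPot w₅ ω₅ (13/4000),
level (−0.7175 + 1/100, −C_T, −1/100), capped scale D, radius ϱ ≥ max (5, R′ + ρ, ρ, R′, 13/10·D + 1)) ⟹ AperiodicFrustratedLawGap`. [folklore chaining] -/
theorem aperiodicFrustratedLawGap_of_schurMotif_five {CT CE DE D ϱ R' ρ B : ℝ} {F : TransferRule}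
    (hDoor : Summit.AtomisticToContinuum.Crystallization.Theses.GrainCoreNetworkSplit.MuEquilibriumDoor)
    (hSF : SF₅) (hU : PeriodicEnergyCeiling (-(7175 / 10000)))
    (hE : SchurElasticPricing (1 / 20) (1 / 8) w₅ ω₅ (13 / 4000) (-(7175 / 10000)) (1 / 1000) CE DE)
    (hF₁ : HasRange R' F) (hF₂ : IsLocal ρ F) (hF₃ : IsBounded B F)
    (hR : 5 ≤ ϱ) (hRρ : R' + ρ ≤ ϱ) (hρ : ρ ≤ ϱ) (hR' : R' ≤ ϱ) (hD : 13 / 10 * D + 1 ≤ ϱ) (hC : 0 ≤ CT)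
    (h : PairRuleMotifCertificate (1 / 20) (1 / 8) (effPot w₅ ω₅ (13 / 4000)) (13 / 4000) (-(7175 / 10000) + 1 / 100) (-CT) (-(1 / 100))
      D ϱ F) :
    Summit.AtomisticToContinuum.Crystallization.Theses.FrustratedLawDichotomy.AperiodicFrustratedLawGap :=
  aperiodicFrustratedLawGap_of_schurMotif (by norm_num) hDoor hSF hU (by norm_num) (by norm_num) hE
    (fun r hr => effPot_five_eq_zero _ hr) hF₁ hF₂ hF₃ (by linarith) hR hRρ hρ hR' hD hC h

/-- **Mixed form** (E′ kept infinite-range, as in generation 33): `MuEquilibriumDoor ∧ E′(1/20,1/8) ∧ SF₅ ∧ UP(−0.7175) ∧ rule ∧ motif certificate ⟹ crux`.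
[folklore chaining] -/
theorem aperiodicFrustratedLawGap_of_elastic_of_schurMotif_five {CT D ϱ R' ρ B : ℝ} {F : TransferRule}
    (hDoor : Summit.AtomisticToContinuum.Crystallization.Theses.GrainCoreNetworkSplit.MuEquilibriumDoor)
    (hE : ElasticPricing (1 / 20) (1 / 8)) (hSF : SF₅) (hU : PeriodicEnergyCeiling (-(7175 / 10000)))
    (hF₁ : HasRange R' F) (hF₂ : IsLocal ρ F) (hF₃ : IsBounded B F)
    (hR : 5 ≤ ϱ) (hRρ : R' + ρ ≤ ϱ) (hρ : ρ ≤ ϱ) (hR' : R' ≤ ϱ) (hD : 13 / 10 * D + 1 ≤ ϱ) (hC : 0 ≤ CT)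
    (h : PairRuleMotifCertificate (1 / 20) (1 / 8) (effPot w₅ ω₅ (13 / 4000)) (13 / 4000) (-(7175 / 10000) + 1 / 100) (-CT) (-(1 / 100))
      D ϱ F) :
    Summit.AtomisticToContinuum.Crystallization.Theses.FrustratedLawDichotomy.AperiodicFrustratedLawGap :=
  aperiodicFrustratedLawGap_of_fdg hDoor
    (fdg_of_elastic_of_schurCut (by norm_num) hE hSF hU (by norm_num)
      (schurTopologicalPricing_of_motif (fun r hr => effPot_five_eq_zero _ hr) hF₁ hF₂ hF₃ (by linarith) hR hRρ hρ hR' hD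
        (by norm_num) hC h))

end Summit.AtomisticToContinuum.Crystallization.Theorems.FrustratedLawDichotomyPairPotentialDoor

end
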